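import Literature.IUT.LogVolume.PilotDivisors
import Literature.IUT.LogVolume.FakeAdeleIndex
import Mathlib.Tactic.Positivity
import HarnessLib

/-!
# The (Ind1) slot residue of pilot data — the quantity any hull-volume estimate must dominate

Dupuy–Hilado, *The statement of Mochizuki's Corollary 3.12*, arXiv:2004.13228 [DupuyHilado2025], §3.3
(pilot divisors `P_q`, `P_Θ = (P_{Θ,j})_j`, `P_{Θ,j} = Σ_{v∈S} j²·ord_v(q_v)/(2l)·[v]`), §3.6 / Def. 3.6.3
(the weighted averages `ln ν̄_{𝔸^{⊗ j+1}_{V̲,p}} = 𝔼(… : v⃗ ∈ V(F₀)_p^{j+1})`, weights `Pr(v) = n_v/[F₀:ℚ]`,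
procession average `(1/ℓ⋇)Σ_{j=1}^{ℓ⋇}`), §4.7 ((Ind1) = permutations of the tensor factors), §4.11–4.12
(`U_Θ`, its hull); S. Mochizuki, *IUT IV* (RIMS ms Apr. 2020) [Mochizuki2012], proof of Thm. 1.10, Step (v)
p. 27–28: "`i†` to be `j ∈ S±_{j+1}`; · "`λ`" to be … "`ord(−)`" of the element `q_{v_j}^{j²}` … if
`v_j ∈ V^bad`", "unlike the other terms …, "`λ`" is asymmetric with respect to the choice of "`i† ∈ I`" …
after symmetrizing with respect to the choice of "`i† ∈ I`" in `S±_{j+1}`, this upper bound may be written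
in the form "`β_e`" … after passing to weighted averages, the operation of symmetrizing … does not affect
the computation of the upper bound under consideration."

PURELY COMBINATORIAL FILE (pilot data only — no packets, no volumes, no ideles). For pilot data
`X = (F, j_E, S, l)` and a finite set of indices `T` it defines, with
`θ_j(v) := P_{Θ,j}(v)·ln|κ(v)|/n_v` (the `ℚ_p`-normalised size of the theta value at `v`; `= −ln|t_{j,v}|_p`
for ANY idele `t` realising `P_Θ`, Dupuy–Hilado (3.4)):
* `PilotData.slotValue X i v = θ_{i+1}(v)`;
* `PilotData.ndegLgpOn X T = Σ_{p∈T} (1/ℓ⋇) Σ_j Σ_{v⃗∈V(F)_p^{j+1}} θ_j(v⃗(j))·Π_k Pr(v⃗(k))` — the text's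
  "last slot `i† = j`" aggregate (it IS `deĝ̲_lgp(P_Θ)` when `T` contains the residue characteristics of
  `S`: summit-side `DHData.lnνL_regionΘ`, Dupuy–Hilado Thm. 3.10.1);
* `PilotData.ndegLgpSlotMin X T = Σ_{p∈T} (1/ℓ⋇) Σ_j Σ_{v⃗} (min_k θ_j(v⃗(k)))·Π_k Pr(v⃗(k))` — the
  "least divisible slot" aggregate, which is what the hull of the UNION of the (Ind1)-permuted regions
  sees (HOME/plan/c312/STEPV-IND1-NOTE.md §2; kernel per summand: abc-iut-c312-d1's
  `MultiradialRegionInd1Bound.le_of_logμ_hullUTheta_le`);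
* `PilotData.slotResidue X T = ndegLgpOn − ndegLgpSlotMin ≥ 0` — the **slot residue**: `0` when `θ_j` is
  constant on every `V(F)_p`, `p ∈ T` (`slotResidue_eq_zero_of_const`), in particular when every `V(F)_p`
  is a singleton (`slotResidue_eq_zero_of_card_le_one`; e.g. `F = ℚ`, `slotResidue_eq_zero_of_finrank_eq_one`).
The companion files `MultiradialRegionSlotBound.lean` (Literature) and `LDHSlotResidue.lean` (summit side)
prove that EVERY upper bound `δ` on the discrepancy of the hull volume of `U_Θ` (any DH datum, any genuine
Θ-volume input, any genuine datum at a `λ`-line point) satisfies `slotResidue ≤ δ`.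
Nothing here takes a side on [IUTchIII] Cor. 3.12 or asserts anything about [IUTchIV] Thm. 1.10 beyond
the displayed consequences of the typed definitions; typed ≠ endorsed.
-/

noncomputable section

namespace Literature.IUT.LogVolume

open NumberField IsDedekindDomain Finset

namespace PilotData

variable {F : Type*} [Field F] [NumberField F] (X : PilotData F)

/-- `θ_j(v) := P_{Θ,j}(v)·ln|κ(v)|/n_v` (`j = i+1`): the `ℚ_p`-normalised size of the theta value of the
pilot divisor at the place `v` — for any idele `t` with `ord_v(t_{j,v}) = P_{Θ,j}(v)` this is `−ln|t_{j,v}|_p`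
of Dupuy–Hilado (3.4); it is the "`λ·log(p_{v_ℚ})`"-type gain that [IUTchIV] Thm. 1.10 Step (v) attaches to
the distinguished slot. [cite: DupuyHilado2025, §3.3–3.4] -/
def slotValue (i : Fin X.lstar) (v : HeightOneSpectrum (𝓞 F)) : ℝ :=
  X.thetaPilot i v * logNorm F v / (localDegree F v : ℝ)

/-- **The last-slot aggregate** `Σ_{p∈T} (1/ℓ⋇) Σ_j Σ_{v⃗∈V(F)_p^{j+1}} θ_j(v⃗(j))·Π_k Pr(v⃗(k))`: the
weighted/procession average of the theta gain read at the LAST slot `i† = j` of each collection `v⃗`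
([IUTchIV] Step (v) "`i†` to be `j`"); equals `deĝ̲_lgp(P_Θ)` when `T` contains the residue characteristics
of `S` (Dupuy–Hilado Thm. 3.10.1, summit-side `DHData.ndegLgpOn_eq_ndegLgp`).
[cite: Mochizuki2012, IUTchIV Thm. 1.10 Step (v) p. 27] -/
def ndegLgpOn (T : Finset ℕ) : ℝ :=
  ∑ p ∈ T, (1 / (X.lstar : ℝ)) * ∑ i : Fin X.lstar,
    ∑ e : Fin ((i : ℕ) + 1 + 1) → placesOver F p,
      X.slotValue i (e (Fin.last _)).1 * ∏ k, weight F (e k).1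

/-- **The least-slot aggregate** `Σ_{p∈T} (1/ℓ⋇) Σ_j Σ_{v⃗∈V(F)_p^{j+1}} (min_k θ_j(v⃗(k)))·Π_k Pr(v⃗(k))`:
the same average with the gain read at the LEAST divisible slot of each collection — what the hull of the
union of the (Ind1)-permuted regions delivers (STEPV-IND1-NOTE §2; Dupuy–Hilado §4.7, §4.11–4.12).
[cite: DupuyHilado2025, §4.7, §4.11, §4.12] -/
def ndegLgpSlotMin (T : Finset ℕ) : ℝ :=
  ∑ p ∈ T, (1 / (X.lstar : ℝ)) * ∑ i : Fin X.lstar,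
    ∑ e : Fin ((i : ℕ) + 1 + 1) → placesOver F p,
      Finset.univ.inf' Finset.univ_nonempty (fun k => X.slotValue i (e k).1) * ∏ k, weight F (e k).1

/-- **The (Ind1) slot residue** `slotResidue X T := ndegLgpOn X T − ndegLgpSlotMin X T` — the weighted
average over collections of `θ_j(v⃗(j)) − min_k θ_j(v⃗(k)) ≥ 0`: the part of the last-slot gain that the hull
of the union over the factor permutations does not see. [cite: DupuyHilado2025, §4.7, §4.11, §4.12] -/
def slotResidue (T : Finset ℕ) : ℝ := X.ndegLgpOn T - X.ndegLgpSlotMin T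

/-- The residue, written as ONE weighted sum of the nonnegative slot defects
`θ_j(v⃗(j)) − min_k θ_j(v⃗(k))`. [cite: DupuyHilado2025, §4.7] -/
theorem slotResidue_eq_sum (T : Finset ℕ) :
    X.slotResidue T = ∑ p ∈ T, (1 / (X.lstar : ℝ)) * ∑ i : Fin X.lstar,
      ∑ e : Fin ((i : ℕ) + 1 + 1) → placesOver F p,
        (X.slotValue i (e (Fin.last _)).1
          - Finset.univ.inf' Finset.univ_nonempty (fun k => X.slotValue i (e k).1)) *
          ∏ k, weight F (e k).1 := by
  unfold slotResidue ndegLgpOn ndegLgpSlotMin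
  rw [← Finset.sum_sub_distrib]
  refine Finset.sum_congr rfl fun p _ => ?_
  rw [← mul_sub, ← Finset.sum_sub_distrib]
  congr 1
  refine Finset.sum_congr rfl fun i _ => ?_
  rw [← Finset.sum_sub_distrib]
  refine Finset.sum_congr rfl fun e _ => ?_
  ring

/-- The product weight of a collection is nonnegative. [cite: DupuyHilado2025, §3.6] -/
theorem prod_weight_nonneg {p : ℕ} {n : ℕ} (e : Fin n → placesOver F p) :
    0 ≤ ∏ k, weight F (e k).1 :=
  Finset.prod_nonneg fun k _ => weight_nonneg F (e k).1

/-- The least slot value is at most the last slot value. [folklore] -/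
private theorem inf'_slotValue_le_last {p : ℕ} (i : Fin X.lstar) (e : Fin ((i : ℕ) + 1 + 1) → placesOver F p) :
    Finset.univ.inf' Finset.univ_nonempty (fun k => X.slotValue i (e k).1) ≤
      X.slotValue i (e (Fin.last _)).1 :=
  Finset.inf'_le _ (Finset.mem_univ _)

/-- `ndegLgpSlotMin ≤ ndegLgpOn` (least slot ≤ last slot, termwise). [cite: DupuyHilado2025, §4.7] -/
theorem ndegLgpSlotMin_le_ndegLgpOn (T : Finset ℕ) : X.ndegLgpSlotMin T ≤ X.ndegLgpOn T := by
  unfold ndegLgpSlotMin ndegLgpOn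
  refine Finset.sum_le_sum fun p _ => ?_
  refine mul_le_mul_of_nonneg_left ?_ (by positivity)
  refine Finset.sum_le_sum fun i _ => Finset.sum_le_sum fun e _ => ?_
  exact mul_le_mul_of_nonneg_right (X.inf'_slotValue_le_last i e) (prod_weight_nonneg e)

/-- **The slot residue is nonnegative.** [cite: DupuyHilado2025, §4.7] -/
theorem slotResidue_nonneg (T : Finset ℕ) : 0 ≤ X.slotResidue T :=
  sub_nonneg.mpr (X.ndegLgpSlotMin_le_ndegLgpOn T)

/-- **Slot-constant pilot data have no residue**: if for every `p ∈ T` and every `j` the gain `θ_j` is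
constant on `V(F)_p`, then `slotResidue X T = 0` (minimum = last slot in every collection) — the case in
which [IUTchIV] Step (v)'s "symmetrizing … does not affect the computation" is harmless for the hull of the
union. [cite: Mochizuki2012, IUTchIV Thm. 1.10 Step (v) p. 28] -/
theorem slotResidue_eq_zero_of_const (T : Finset ℕ)
    (h : ∀ p ∈ T, ∀ (i : Fin X.lstar) (v w : placesOver F p), X.slotValue i v.1 = X.slotValue i w.1) :
    X.slotResidue T = 0 := by
  rw [slotResidue_eq_sum]
  refine Finset.sum_eq_zero fun p hp => ?_
  rw [Finset.sum_eq_zero fun i _ => ?_, mul_zero]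
  refine Finset.sum_eq_zero fun e _ => ?_
  have hconst : Finset.univ.inf' Finset.univ_nonempty (fun k => X.slotValue i (e k).1) =
      X.slotValue i (e (Fin.last _)).1 := by
    refine le_antisymm (Finset.inf'_le _ (Finset.mem_univ _)) ?_
    exact Finset.le_inf' _ _ fun k _ => (h p hp i (e (Fin.last _)) (e k)).le
  rw [hconst, sub_self, zero_mul]

/-- **One place over each `p ∈ T` ⇒ no residue** (every collection is constant).
[cite: DupuyHilado2025, §4.7] -/
theorem slotResidue_eq_zero_of_card_le_one (T : Finset ℕ) (h : ∀ p ∈ T, (placesOver F p).card ≤ 1) :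
    X.slotResidue T = 0 := by
  refine X.slotResidue_eq_zero_of_const T fun p hp i v w => ?_
  have hvw : v = w := by
    have := Finset.card_le_one.mp (h p hp) v.1 v.2 w.1 w.2
    exact Subtype.ext this
  rw [hvw]

/-- The number of places over a prime `p` is at most `[F:ℚ]` (each has local degree `n_v ≥ 1` and
`Σ_v n_v = [F:ℚ]`). [cite: DupuyHilado2025, §3.6] -/
theorem card_placesOver_le_finrank (p : ℕ) [Fact p.Prime] :
    (placesOver F p).card ≤ Module.finrank ℚ F := by
  rw [← sum_localDegree F p, Finset.card_eq_sum_ones]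
  exact Finset.sum_le_sum fun v _ => localDegree_pos F v

/-- **`F = ℚ` (degree one) ⇒ no residue** at any set of primes `T`: the situation of the summit route
at `d_mod = 1` ([IUTchIV] Thm. 1.10 with `F_mod = ℚ`), where last slot, least slot and average coincide.
[cite: Mochizuki2012, IUTchIV Thm. 1.10 Step (v) p. 28] -/
theorem slotResidue_eq_zero_of_finrank_eq_one (T : Finset ℕ) (hT : ∀ p ∈ T, p.Prime)
    (hF : Module.finrank ℚ F = 1) : X.slotResidue T = 0 := by
  refine X.slotResidue_eq_zero_of_card_le_one T fun p hp => ?_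
  haveI : Fact p.Prime := ⟨hT p hp⟩
  exact (card_placesOver_le_finrank (F := F) p).trans hF.le

end PilotData

end Literature.IUT.LogVolume

end
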